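import Mathlib
import Summits.Langlands.Langlands.Theorems.IwahoriTransientSplitCertificate

/-!
# IwahoriTransient — ULTRAMETRIC ROOT CONTINUITY AND ROOT-PAIR MATCHING (DAG edge part 1c) — lens-3 gen 26, cell `decomp-langlands`

Over `ℚ̄_ℓ`, for monic `P`, `Q` of degree `n` with integral roots and coefficientwise `‖P − Q‖ < ε ≤ 1`:
* §5 `exists_root_pow_lt_of_coeff_lt` — a root `β` of `P` has a root `α` of `Q` with `‖β − α‖^n < ε` (`‖Q(β)‖ = ∏ ‖β − α‖`);
* §9 `rootPairMatching` (was stub S2 of the skeleton `SemistableShapingOfAvatars`, PROVED in the provable exponent `n·n`): a SUB-MULTISET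
  pair `{a, b} ≤ roots P` is matched by a SUB-MULTISET pair `{a', b'} ≤ roots Q` with `‖a − a'‖^n < ε`, `‖b − b'‖^{n·n} < ε` — by
  DEFLATION: `P = (X − a)P₁`, `Q = (X − a')Q₁`, `(X − a)(P₁ − Q₁) = (P − Q) − (a' − a)Q₁`, so `P₁ − Q₁` is coefficientwise `≤ max(ε, ‖a − a'‖)`
  (`Polynomial.coeff_divByMonic_X_sub_C`; integral coefficients `norm_coeff_le_one_of_roots`) and §5 applies to `b ∈ roots P₁` in degree `n − 1`.
  (Single-root pigeonhole alone does not give a sub-multiset pair: `a`, `b = a/q` may snap to ONE simple root of `Q` when `q ≡ 1 mod ℓ^N`.)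
Mathlib + the certificate only; no `def`; 0 sorry.
-/

set_option linter.dupNamespace false
set_option linter.unusedVariables false

namespace Summit.Langlands.Langlands.Theorems.IwahoriTransient

open scoped Polynomial Matrix
open Polynomial

/-! ## 5. ROOT PIGEONHOLE (the level-raising pair transfers): a root of `P` is close to SOME root of a coefficient-close monic `Q`
(over `ℚ̄_ℓ`, integral root).  Used with `P = charpoly ρ_r(Φ_v)` (an exact `q_v`-ratio pair `a = q_v b` at an Iwahori, non-spherical
place of the approximant — `N ≠ 0`) and `Q = charpoly ρ(Φ_v)`: the target acquires an APPROXIMATE level-raising pair. -/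
section Roots
variable {ℓ : ℕ} [Fact ℓ.Prime]

/-- finitely many coefficients each of norm `< ε` admit a common bound `C < ε`, `0 ≤ C`. -/
theorem exists_coeff_bound_lt (R : (PadicAlgCl ℓ)[X]) {ε : ℝ} (hε : 0 < ε) (h : ∀ i, ‖R.coeff i‖ < ε) :
    ∃ C : ℝ, 0 ≤ C ∧ C < ε ∧ ∀ i, ‖R.coeff i‖ ≤ C := by
  by_cases hs : R.support.Nonempty
  · have hne : (R.support.image fun i => ‖R.coeff i‖).Nonempty := hs.image _
    obtain ⟨j, hj⟩ := hs
    have hC0 : 0 ≤ (R.support.image fun i => ‖R.coeff i‖).max' hne :=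
      (norm_nonneg (R.coeff j)).trans (Finset.le_max' _ ‖R.coeff j‖ (Finset.mem_image_of_mem (fun i => ‖R.coeff i‖) hj))
    refine ⟨(R.support.image fun i => ‖R.coeff i‖).max' hne, hC0, ?_, fun i => ?_⟩
    · refine (Finset.max'_lt_iff _ hne).mpr fun x hx => ?_
      obtain ⟨i, -, rfl⟩ := Finset.mem_image.mp hx
      exact h i
    · by_cases hi : i ∈ R.support
      · exact Finset.le_max' _ ‖R.coeff i‖ (Finset.mem_image_of_mem (fun i => ‖R.coeff i‖) hi)
      · rw [Polynomial.notMem_support_iff.mp hi, norm_zero]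
        exact hC0
  · refine ⟨0, le_rfl, hε, fun i => ?_⟩
    have hR : R = 0 := by
      rwa [Finset.not_nonempty_iff_eq_empty, Polynomial.support_eq_empty] at hs
    simp [hR]

/-- over `ℚ̄_ℓ`, `‖Q(β)‖₊ = ∏_{α ∈ roots Q} ‖β − α‖₊` for monic `Q`. -/
theorem nnnorm_eval_eq_prod_roots {Q : (PadicAlgCl ℓ)[X]} (hQ : Q.Monic) (β : PadicAlgCl ℓ) :
    ‖Q.eval β‖₊ = (Q.roots.map fun α => ‖β - α‖₊).prod := by
  haveI : IsAlgClosed (PadicAlgCl ℓ) := AlgebraicClosure.isAlgClosed _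
  have hs : Q.Splits := IsAlgClosed.splits Q
  have hprod : Q.eval β = (Q.roots.map fun α => β - α).prod := by
    conv_lhs => rw [hs.eq_prod_roots_of_monic hQ]
    rw [Polynomial.eval_multiset_prod, Multiset.map_map]
    refine congrArg _ (Multiset.map_congr rfl fun α _ => ?_)
    simp
  rw [hprod, ← nnnormHom_apply, map_multiset_prod, Multiset.map_map]
  rfl

/-- ROOT PIGEONHOLE: `Q` monic of degree `n ≠ 0`, `β` an integral root of `P`, `P − Q` coefficientwise of norm `< ε` ⇒ some root `α`
of `Q` has `‖β − α‖^n < ε`. -/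
theorem exists_root_pow_lt_of_coeff_lt {n : ℕ} (hn : n ≠ 0) {P Q : (PadicAlgCl ℓ)[X]} (hQ : Q.Monic) (hdeg : Q.natDegree = n)
    {β : PadicAlgCl ℓ} (hβ : ‖β‖ ≤ 1) (hPβ : P.IsRoot β) {ε : ℝ} (hε : 0 < ε)
    (hclose : ∀ i, ‖(P - Q).coeff i‖ < ε) : ∃ α ∈ Q.roots, ‖β - α‖ ^ n < ε := by
  haveI : IsAlgClosed (PadicAlgCl ℓ) := AlgebraicClosure.isAlgClosed _
  have hs : Q.Splits := IsAlgClosed.splits Q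
  obtain ⟨C, hC0, hCε, hC⟩ := exists_coeff_bound_lt (P - Q) hε hclose
  have hQβ : ‖Q.eval β‖ < ε := by
    have h1 : Q.eval β = -((P - Q).eval β) := by rw [Polynomial.eval_sub, hPβ.eq_zero]; ring
    rw [h1, norm_neg]
    exact (norm_eval_le_of_coeff_le hβ hC0 hC).trans_lt hCε
  have hcard : (Q.roots.map fun α => ‖β - α‖₊ ^ n).card = n := by
    rw [Multiset.card_map, ← hs.natDegree_eq_card_roots, hdeg]
  by_contra hne
  push Not at hne
  have hle : ∀ x ∈ (Q.roots.map fun α => ‖β - α‖₊ ^ n), ε.toNNReal ≤ x := by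
    intro x hx
    obtain ⟨α, hα, rfl⟩ := Multiset.mem_map.mp hx
    have := hne α hα
    exact Real.toNNReal_le_iff_le_coe.mpr (by simpa using this)
  have hpow := Multiset.pow_card_le_prod hle
  rw [hcard, Multiset.prod_map_pow, ← nnnorm_eval_eq_prod_roots hQ β] at hpow
  have hεle : ε.toNNReal ≤ ‖Q.eval β‖₊ := le_of_pow_le_pow_left₀ hn (by positivity) hpow
  have : ε ≤ ‖Q.eval β‖ := by
    have h := NNReal.coe_le_coe.mpr hεle
    rwa [Real.coe_toNNReal _ hε.le, coe_nnnorm] at h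
  exact absurd hQβ (not_lt.mpr this)

/-- the dictionary instance: an EXACT pair `a = q·b` among the roots of `P` (monodromy `N ≠ 0` at an Iwahori place of the approximant)
and coefficient-closeness to the monic `Q` of the same degree give roots `a', b'` of `Q` with `‖a − a'‖^n, ‖b − b'‖^n < ε`
(an APPROXIMATE level-raising pair for the target; the multiset refinement `{a', b'} ≤ Q.roots` when `a' = b'` is part 2's
root-MATCHING stub, see NEXT-g27.md §S2'). -/
theorem exists_pair_near_of_coeff_lt {n : ℕ} (hn : n ≠ 0) {P Q : (PadicAlgCl ℓ)[X]} (hQ : Q.Monic) (hdeg : Q.natDegree = n)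
    {a b : PadicAlgCl ℓ} (ha : ‖a‖ ≤ 1) (hb : ‖b‖ ≤ 1) (hPa : P.IsRoot a) (hPb : P.IsRoot b) {ε : ℝ} (hε : 0 < ε)
    (hclose : ∀ i, ‖(P - Q).coeff i‖ < ε) :
    ∃ a' ∈ Q.roots, ∃ b' ∈ Q.roots, ‖a - a'‖ ^ n < ε ∧ ‖b - b'‖ ^ n < ε := by
  obtain ⟨a', ha', h1⟩ := exists_root_pow_lt_of_coeff_lt hn hQ hdeg ha hPa hε hclose
  obtain ⟨b', hb', h2⟩ := exists_root_pow_lt_of_coeff_lt hn hQ hdeg hb hPb hε hclose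
  exact ⟨a', ha', b', hb', h1, h2⟩
end Roots


/-! ## 9. ROOT-PAIR MATCHING by deflation -/
section Matching

variable {ℓ : ℕ} [Fact ℓ.Prime]

/-- ultrametric inequality for differences. -/
theorem norm_sub_le_max' (x y : PadicAlgCl ℓ) : ‖x - y‖ ≤ max ‖x‖ ‖y‖ := by
  simpa [sub_eq_add_neg, norm_neg] using IsUltrametricDist.norm_add_le_max x (-y)

/-- coefficients of `p /ₘ (X − a)` are bounded by the coefficient bound of `p` when `‖a‖ ≤ 1` (`coeff_divByMonic_X_sub_C`, ultrametric). -/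
theorem norm_coeff_divByMonic_le (p : (PadicAlgCl ℓ)[X]) {a : PadicAlgCl ℓ} (ha : ‖a‖ ≤ 1) {M : ℝ} (hM : 0 ≤ M)
    (hp : ∀ i, ‖p.coeff i‖ ≤ M) (k : ℕ) : ‖(p /ₘ (X - C a)).coeff k‖ ≤ M := by
  rw [coeff_divByMonic_X_sub_C]
  refine IsUltrametricDist.norm_sum_le_of_forall_le_of_nonneg hM fun i _ => ?_
  rw [norm_mul, norm_pow]
  exact (mul_le_of_le_one_left (norm_nonneg _) (pow_le_one₀ (norm_nonneg _) ha)).trans (hp i)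

/-- a monic polynomial over `ℚ̄_ℓ` all of whose roots are integral has integral coefficients. -/
theorem norm_coeff_le_one_of_roots {Q : (PadicAlgCl ℓ)[X]} (hQ : Q.Monic) (hr : ∀ β ∈ Q.roots, ‖β‖ ≤ 1) (i : ℕ) :
    ‖Q.coeff i‖ ≤ 1 := by
  haveI : IsAlgClosed (PadicAlgCl ℓ) := AlgebraicClosure.isAlgClosed _
  have hs : Q.Splits := IsAlgClosed.splits Q
  have key : ∀ (s : Multiset (PadicAlgCl ℓ)), (∀ β ∈ s, ‖β‖ ≤ 1) → ∀ i, ‖((s.map fun α => X - C α).prod).coeff i‖ ≤ 1 := by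
    intro s
    induction s using Multiset.induction_on with
    | empty =>
      intro _ i
      simp only [Multiset.map_zero, Multiset.prod_zero, coeff_one]
      split_ifs <;> simp
    | cons α s ih =>
      intro hαs i
      have hα : ‖α‖ ≤ 1 := hαs α (Multiset.mem_cons_self _ _)
      have ih' := ih (fun β hβ => hαs β (Multiset.mem_cons_of_mem hβ))
      rw [Multiset.map_cons, Multiset.prod_cons, mul_comm]
      rcases i with _ | i
      · rw [mul_coeff_zero, coeff_sub, coeff_X_zero, coeff_C_zero, zero_sub, mul_neg, norm_neg, norm_mul]
        exact (mul_le_mul (ih' 0) hα (norm_nonneg _) zero_le_one).trans (one_mul (1 : ℝ)).le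
      · rw [coeff_mul_X_sub_C]
        refine (norm_sub_le_max' _ _).trans (max_le (ih' i) ?_)
        rw [norm_mul]
        exact (mul_le_mul (ih' (i + 1)) hα (norm_nonneg _) zero_le_one).trans (one_mul (1 : ℝ)).le
  have hQ' := key Q.roots hr i
  rwa [← hs.eq_prod_roots_of_monic hQ] at hQ'

/-- deflation: for a root `a` of the monic `P`, `P = (X − a) · P₁` with `P₁ := P /ₘ (X − a)` monic, `natDegree P₁ = natDegree P − 1` and
`roots P = a ::ₘ roots P₁`. -/
theorem deflate {P : (PadicAlgCl ℓ)[X]} (hP : P.Monic) {a : PadicAlgCl ℓ} (ha : P.IsRoot a) :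
    (X - C a) * (P /ₘ (X - C a)) = P ∧ (P /ₘ (X - C a)).Monic ∧ (P /ₘ (X - C a)).natDegree = P.natDegree - 1 ∧
      P.roots = a ::ₘ (P /ₘ (X - C a)).roots := by
  have hmul : (X - C a) * (P /ₘ (X - C a)) = P := mul_divByMonic_eq_iff_isRoot.mpr ha
  have hmon : (P /ₘ (X - C a)).Monic := by
    refine Monic.of_mul_monic_left (monic_X_sub_C a) ?_
    rw [hmul]; exact hP
  refine ⟨hmul, hmon, by rw [natDegree_divByMonic P (monic_X_sub_C a), natDegree_X_sub_C], ?_⟩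
  conv_lhs => rw [← hmul]
  rw [roots_mul (by rw [hmul]; exact hP.ne_zero), roots_X_sub_C]
  rfl

/-- S2 PROVED (exponent `n·n`): ROOT-PAIR MATCHING. -/
theorem rootPairMatching {n : ℕ} (hn : n ≠ 0) {P Q : (PadicAlgCl ℓ)[X]} (hP : P.Monic) (hQ : Q.Monic)
    (hPd : P.natDegree = n) (hQd : Q.natDegree = n) (hPr : ∀ β ∈ P.roots, ‖β‖ ≤ 1) (hQr : ∀ β ∈ Q.roots, ‖β‖ ≤ 1)
    {ε : ℝ} (hε : 0 < ε) (hε1 : ε ≤ 1) (hclose : ∀ i, ‖(P - Q).coeff i‖ < ε)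
    {a b : PadicAlgCl ℓ} (hab : ({a, b} : Multiset (PadicAlgCl ℓ)) ≤ P.roots) :
    ∃ a' b' : PadicAlgCl ℓ, ({a', b'} : Multiset (PadicAlgCl ℓ)) ≤ Q.roots ∧ ‖a - a'‖ ^ n < ε ∧ ‖b - b'‖ ^ (n * n) < ε := by
  -- unpack the sub-multiset pair
  have haP : a ∈ P.roots := Multiset.mem_of_le hab (by simp)
  have hPa : P.IsRoot a := (mem_roots hP.ne_zero).mp haP
  obtain ⟨hmulP, hP1, hP1d, hProots⟩ := deflate hP hPa
  have hbP1 : b ∈ (P /ₘ (X - C a)).roots := by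
    have h1 : ({a, b} : Multiset (PadicAlgCl ℓ)) = a ::ₘ {b} := rfl
    rw [h1, hProots] at hab
    exact Multiset.singleton_le.mp ((Multiset.cons_le_cons_iff a).mp hab)
  have hbP : b ∈ P.roots := by rw [hProots]; exact Multiset.mem_cons_of_mem hbP1
  -- `n ≥ 2`
  have hn2 : 2 ≤ n := by
    have h1 := Multiset.card_le_card hab
    have h2 := P.card_roots'
    rw [hPd] at h2
    have h3 : Multiset.card ({a, b} : Multiset (PadicAlgCl ℓ)) = 2 := rfl
    omega
  have hn1 : n - 1 ≠ 0 := by omega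
  -- `a'`
  obtain ⟨a', ha'Q, haa'⟩ := exists_root_pow_lt_of_coeff_lt hn hQ hQd (hPr a haP) hPa hε hclose
  have hQa' : Q.IsRoot a' := (mem_roots hQ.ne_zero).mp ha'Q
  obtain ⟨hmulQ, hQ1, hQ1d, hQroots⟩ := deflate hQ hQa'
  set P₁ := P /ₘ (X - C a) with hP₁
  set Q₁ := Q /ₘ (X - C a') with hQ₁
  have hQ1r : ∀ β ∈ Q₁.roots, ‖β‖ ≤ 1 := fun β hβ => hQr β (by rw [hQroots]; exact Multiset.mem_cons_of_mem hβ)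
  -- `(X − a)(P₁ − Q₁) = (P − Q) − (a' − a) Q₁ =: R`
  set δ := ‖a - a'‖ with hδ
  have hδn : δ ^ n < ε := haa'
  have hδ1 : δ ≤ 1 := by
    rw [hδ]; exact (norm_sub_le_max' a a').trans (max_le (hPr a haP) (hQr a' ha'Q))
  set R := (P - Q) - C (a' - a) * Q₁ with hR
  have hRD : (X - C a) * (P₁ - Q₁) = R := by
    rw [hR, mul_sub, hmulP, ← hmulQ]; simp only [map_sub]; ring
  have hD : P₁ - Q₁ = R /ₘ (X - C a) := by
    rw [← hRD, mul_divByMonic_cancel_left _ (monic_X_sub_C a)]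
  -- coefficient bound of `R`, then of `P₁ − Q₁`
  obtain ⟨ε', hε'0, hε'ε, hε'⟩ := exists_coeff_bound_lt (P - Q) hε hclose
  have hRc : ∀ i, ‖R.coeff i‖ ≤ max ε' δ := by
    intro i
    rw [hR, coeff_sub, coeff_C_mul]
    refine (norm_sub_le_max' _ _).trans (max_le_max (hε' i) ?_)
    rw [norm_mul, norm_sub_rev]
    exact (mul_le_of_le_one_right (norm_nonneg _) (norm_coeff_le_one_of_roots hQ1 hQ1r i))
  have hDc : ∀ k, ‖(P₁ - Q₁).coeff k‖ ≤ max ε' δ := by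
    intro k; rw [hD]
    exact norm_coeff_divByMonic_le R (hPr a haP) ((hε'0).trans (le_max_left _ _)) hRc k
  -- strictify: some `ε₂ > max ε' δ` still has `ε₂ ^ n < ε`
  have hpow : (max ε' δ) ^ n < ε := by
    rcases le_total ε' δ with h | h
    · rw [max_eq_right h]; exact hδn
    · rw [max_eq_left h]
      exact (pow_le_of_le_one hε'0 (hε'ε.le.trans hε1) hn).trans_lt hε'ε
  obtain ⟨ε₂, hε₂, hε₂n⟩ : ∃ ε₂ : ℝ, max ε' δ < ε₂ ∧ ε₂ ^ n < ε := by
    have hev : ∀ᶠ x in nhds (max ε' δ), x ^ n < ε :=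
      ((continuous_pow n).continuousAt).eventually_lt continuousAt_const hpow
    obtain ⟨η, hη, hball⟩ := Metric.eventually_nhds_iff.mp hev
    refine ⟨max ε' δ + η / 2, by linarith, hball ?_⟩
    rw [Real.dist_eq, add_sub_cancel_left, abs_of_pos (by linarith)]; linarith
  have hε₂pos : 0 < ε₂ := lt_of_le_of_lt (hε'0.trans (le_max_left ε' δ)) hε₂
  have hDlt : ∀ k, ‖(P₁ - Q₁).coeff k‖ < ε₂ := fun k => (hDc k).trans_lt hε₂
  -- `b'` in degree `n − 1`
  have hP1b : P₁.IsRoot b := (mem_roots hP1.ne_zero).mp hbP1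
  have hQ1d' : Q₁.natDegree = n - 1 := by rw [hQ1d, hQd]
  obtain ⟨b', hb'Q1, hbb'⟩ := exists_root_pow_lt_of_coeff_lt hn1 hQ1 hQ1d' (hPr b hbP) hP1b hε₂pos hDlt
  have hb'Q : b' ∈ Q.roots := by rw [hQroots]; exact Multiset.mem_cons_of_mem hb'Q1
  refine ⟨a', b', ?_, haa', ?_⟩
  · have h1 : ({a', b'} : Multiset (PadicAlgCl ℓ)) = a' ::ₘ {b'} := rfl
    rw [h1, hQroots]
    exact (Multiset.cons_le_cons_iff a').mpr (Multiset.singleton_le.mpr hb'Q1)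
  · have hbb1 : ‖b - b'‖ ≤ 1 := (norm_sub_le_max' b b').trans (max_le (hPr b hbP) (hQr b' hb'Q))
    have hexp : (n - 1) * n ≤ n * n := Nat.mul_le_mul_right _ (Nat.sub_le _ _)
    calc ‖b - b'‖ ^ (n * n) ≤ ‖b - b'‖ ^ ((n - 1) * n) := pow_le_pow_of_le_one (norm_nonneg _) hbb1 hexp
      _ = (‖b - b'‖ ^ (n - 1)) ^ n := pow_mul _ _ _
      _ < ε₂ ^ n := pow_lt_pow_left₀ hbb' (by positivity) hn
      _ < ε := hε₂n

end Matching

end Summit.Langlands.Langlands.Theorems.IwahoriTransient
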